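import Literature.Probability.TransportMaps.DobrushinPecherskySweep
import HarnessLib

/-!
# Sharpness of the swept table: the exponent `Δ^χ` in (28′) is attained, so (28) as printed
# does not follow from Lemma 3.6 (Conache–Kondratiev–Kozitsky–Pasurek 2015, §4)

[topic Probability/TransportMaps]

Companion to `Literature/Probability/TransportMaps/DobrushinPecherskySweep.lean` (the abstract
colour-class sweep of [ConacheEtAl2015, §4]). That file proves, from Lemma 3.4 (b), the one-step
estimates (21)–(24) of Lemma 3.6 and the constants' hypotheses (9), (13), (26a)–(26b), the bound
(27) verbatim and (28′) `λ(ν) ≤ Δ^χ γ(ν₀) + c̄Δ^{χ+1} λ(ν₀)`, whereas print states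
(28) `λ(ν) ≤ Δ^{χ−1} γ(ν₀) + c̄Δ^χ λ(ν₀)` («Since `W_{Δ−1} = ∅` … for `j = Δ − 1` we have just the
first lines in (41) and (42), which yields (27) and (28)»).

THIS FILE is the machine-checked witness behind the reading note E-DP-1 of the pub-ymgap records:
an abstract Dobrushin–Pechersky system on the 4-cycle `0–1–2–3–0` (`Δ = 2`, `χ = 2`, classes
`V₀ = {0, 2}`, `V₁ = {1, 3}`) with `κ ≡ 0`, `c ≡ 0`, `K⁻¹ = 0` — so (9), (13), (26) hold with
`κ̄ = c̄ = AK⁻¹ = 0` — whose maps `R_ℓ` realise (21)–(24) with EQUALITY on the functionals they touch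
and leave all other functionals unchanged (Lemma 3.4 (b)), started from `ν₀(I_ℓ) = 1`,
`ν₀(I_ℓ H_{ℓ'}) = 0` (`γ(ν₀) = 1`, `λ(ν₀) = 0`). After the sweep `R₃ R₁ R₂ R₀`:
`ν(I₁ H₀) = 4 = Δ^χ γ(ν₀) + c̄Δ^{χ+1} λ(ν₀)` — (28′) with equality — while (28) would give `2`.
Hence no argument using only those hypotheses (in particular the printed §4) can yield (28); the
threshold of Theorem 2.6 must be read with `c̄ Δ^{χ+1} < 1` (recorded, with the honest consequence,
in the Sweep file's docstring).

* `Sharpness.sys` — the witness system (state = the two value tables, in `ℕ`);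
  `Sharpness.isDPStep`, `Sharpness.admissible` (`Δ = χ = 2`, `κ̄ = c̄ = α = 0`),
  `Sharpness.col_proper` (parity colouring);
* `Sharpness.value_eq_four` — the swept value; `Sharpness.printed_28_fails` — `4 > Δ^{χ−1}·γ₀ +
  c̄Δ^χ·λ₀ = 2`; `Sharpness.bound_28'_attained` — equality in (28′);
  `Sharpness.lemma_3_7_hypotheses` — all hypotheses of `DPSystem.lemma_3_7` hold for the witness;
  `Sharpness.threshold_nonvacuous` — the threshold of the criterion is met by admissible constants.

Scope (honest): a four-site combinatorial example about the ABSTRACT inequalities; it says nothing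
about actual specifications or measures (where `ν(I_ℓ H_{ℓ'}) ≤ μ_i(h)` gives other a-priori
bounds), and nothing about lattice gauge theory. No named facts.

## References
* [ConacheEtAl2015] D. Conache, Yu. Kondratiev, Yu. Kozitsky, T. Pasurek, arXiv:1501.00673, Lemma 3.6
  (21)–(24), Lemma 3.7 (27)–(28), §4 (39)–(42). Quoted from the held TeX, pp. 9–13.
* [DobrushinPechersky1983] R. L. Dobrushin, E. A. Pechersky, LNM 1021 (1983) 97–110.
-/

noncomputable section

open Finset

open scoped ENNReal NNReal

namespace Literature.Probability.TransportMaps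

namespace DobrushinPecherskySweep

namespace Sharpness

/-- The state of the witness: the table of `ν(I_ℓ)` and the table of `ν(I_ℓ H_{ℓ'})`, natural
numbers. [cite: ConacheEtAl2015, §3.2 (19)–(20)] -/
abbrev WState : Type := (Fin 4 → ℕ) × (Fin 4 → Fin 4 → ℕ)

/-- Neighbours on the 4-cycle: `∂ℓ = {ℓ + 1, ℓ − 1}`. [cite: ConacheEtAl2015, §2.1 (1)] -/
def cycNbr (ℓ : Fin 4) : Finset (Fin 4) := {ℓ + 1, ℓ + 3}

/-- The worst-case one-site map: the functionals touched by `R_ℓ` are SET to the right-hand sides of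
(21)–(24) with `κ = c = 0`, `K⁻¹ = 0` (`I_ℓ ↦ 0`, `I_ℓ H_ℓ ↦ Σ_{ℓ₁∈∂ℓ} I_{ℓ₁}`,
`I_ℓ H_y ↦ Σ_{ℓ₂∈∂ℓ} I_{ℓ₂} H_y`, `I_x H_ℓ ↦ I_x`), all others unchanged (Lemma 3.4 (b)).
[cite: ConacheEtAl2015, Lemma 3.6 (21)–(24)] -/
def worstR (ℓ : Fin 4) (ν : WState) : WState :=
  (Function.update ν.1 ℓ 0,
    fun x y =>
      if x = ℓ then (if y = ℓ then ν.1 (ℓ + 1) + ν.1 (ℓ + 3) else ν.2 (ℓ + 1) y + ν.2 (ℓ + 3) y)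
      else if y = ℓ then ν.1 x else ν.2 x y)

/-- The witness system: 4-cycle, `κ = 0`, `c = 0`, `ε = K⁻¹ = 0`, one marginal.
[cite: ConacheEtAl2015, §3.2–3.3] -/
def sys : DPSystem (Fin 4) WState Unit where
  nbr := cycNbr
  κ := fun _ _ => 0
  c := fun _ _ _ => 0
  ε := 0
  R := worstR
  γf := fun ν ℓ => (ν.1 ℓ : ℝ≥0∞)
  Λ := fun ν _ x y => (ν.2 x y : ℝ≥0∞)

/-- `ℓ + 1 ≠ ℓ + 3` in `Fin 4`. [cite: ConacheEtAl2015, §2.1 (1)] -/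
theorem succ_ne_pred (ℓ : Fin 4) : ℓ + 1 ≠ ℓ + 3 := by revert ℓ; decide

/-- Sums over `∂ℓ` on the 4-cycle are two-term sums. [cite: ConacheEtAl2015, §2.1 (1)] -/
theorem sum_cycNbr (ℓ : Fin 4) (f : Fin 4 → ℝ≥0∞) :
    ∑ x ∈ cycNbr ℓ, f x = f (ℓ + 1) + f (ℓ + 3) := by
  rw [cycNbr, sum_pair (succ_ne_pred ℓ)]

/-- The witness realises Lemma 3.4 (b) and (21)–(24) (with equality where it touches).
[cite: ConacheEtAl2015, Lemma 3.4 (b), Lemma 3.6 (21)–(24)] -/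
theorem isDPStep : sys.IsDPStep where
  γ_of_ne ν ℓ ℓ' h := by
    simp only [sys, worstR, Function.update_of_ne h]; exact le_rfl
  Λ_of_ne ν a ℓ ℓ₁ ℓ₂ h₁ h₂ := by
    simp only [sys, worstR, if_neg h₁, if_neg h₂]; exact le_rfl
  h21 ν ℓ := by
    simp only [sys, worstR, Function.update_self, Nat.cast_zero]; exact bot_le
  h22 ν a ℓ ℓ₁ h₁ := by
    simp only [sys, worstR, if_neg h₁, if_true]; exact le_self_add
  h23 ν a ℓ ℓ₁ h₁ := by
    have h₁' : ¬ ℓ₁ = ℓ := h₁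
    simp only [sys, worstR, if_true, if_neg h₁', Nat.cast_add, sum_cycNbr]
    exact le_rfl
  h24 ν a ℓ := by
    simp only [sys, worstR, if_true, Nat.cast_add, sum_cycNbr, zero_mul, sum_const_zero, add_zero]
    exact le_rfl

/-- The constants: `Δ = 2`, `χ = 2`, `κ̄ = c̄ = α = 0` are admissible. [cite: ConacheEtAl2015, §2.2 (9), (13), §3.3 (26a)–(26b)] -/
theorem admissible : sys.Admissible 2 2 0 0 0 where
  two_le := le_rfl
  card_nbr_le ℓ := by
    simp only [sys, cycNbr]
    exact (card_insert_le _ _).trans (by simp)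
  κ_row ℓ := by simp [sys]
  c_row a ℓ := by simp [sys]
  κbar_le_one := zero_le_one
  cbar_pow_le := by simp
  two_mul_alpha_le := by simp
  h26a := by simp [sys]

/-- The parity colouring `col ℓ = ℓ mod 2` (classes `V₀ = {0, 2}`, `V₁ = {1, 3}`).
[cite: ConacheEtAl2015, §2.1 (3)] -/
def col (ℓ : Fin 4) : Fin 2 := ⟨ℓ.val % 2, Nat.mod_lt _ (by norm_num)⟩

/-- The parity colouring is proper on the 4-cycle. [cite: ConacheEtAl2015, §2.1 (2)–(3)] -/
theorem col_proper : ∀ ℓ, ∀ ℓ' ∈ sys.nbr ℓ, col ℓ' ≠ col ℓ := by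
  simp only [sys, cycNbr]
  decide

/-- The initial state `ν₀`: `ν₀(I_ℓ) = 1`, `ν₀(I_ℓ H_{ℓ'}) = 0`. [cite: ConacheEtAl2015, §3.2 (18), (26)] -/
def ν₀ : WState := (fun _ => 1, fun _ _ => 0)

/-- `γ(ν₀) ≤ 1`. [cite: ConacheEtAl2015, §3.2 (18)] -/
theorem γ_ν₀ (ℓ : Fin 4) : sys.γf ν₀ ℓ ≤ 1 := by simp [sys, ν₀]

/-- `λ(ν₀) ≤ 0`. [cite: ConacheEtAl2015, §3.2 (26)] -/
theorem Λ_ν₀ (a : Unit) (ℓ ℓ' : Fin 4) : sys.Λ ν₀ a ℓ ℓ' ≤ 0 := by simp [sys, ν₀]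

/-- The swept state `ν = R₃ R₁ R₂ R₀ ν₀` (class `V₀ = [0, 2]`, then `V₁ = [1, 3]`).
[cite: ConacheEtAl2015, §4.1 (30), §4.2] -/
def νSwept : WState := sys.sweepList [1, 3] (sys.sweepList [0, 2] ν₀)

/-- **The value:** `ν(I₁ H₀) = 4` after the sweep. [cite: ConacheEtAl2015, §4.2 (42)] -/
theorem value_eq_four : νSwept.2 1 0 = 4 := by
  decide

/-- Hence `λ(ν) ≥ 4`, in the currency of `DPSystem`. [cite: ConacheEtAl2015, §4.2 (42)] -/
theorem Λ_swept_eq : sys.Λ νSwept () 1 0 = 4 := by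
  simp only [sys, value_eq_four, Nat.cast_ofNat]

/-- **(28) as printed fails for the witness:** with `Δ = χ = 2`, `γ(ν₀) = 1`, `λ(ν₀) = 0`, `c̄ = 0`,
print's right-hand side `Δ^{χ−1} γ(ν₀) + c̄Δ^χ λ(ν₀) = 2 < 4 = ν(I₁ H₀)`.
[cite: ConacheEtAl2015, Lemma 3.7 (28)] -/
theorem printed_28_fails :
    (2 : ℝ≥0∞) ^ (2 - 1) * 1 + (0 : ℝ≥0∞) * (2 : ℝ≥0∞) ^ 2 * 0 < sys.Λ νSwept () 1 0 := by
  rw [Λ_swept_eq]; norm_num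

/-- **(28′) is attained:** `ν(I₁ H₀) = Δ^χ γ(ν₀) + c̄Δ^{χ+1} λ(ν₀) = 4`.
[cite: ConacheEtAl2015, §4.2 (42)] -/
theorem bound_28'_attained :
    sys.Λ νSwept () 1 0 = (2 : ℝ≥0∞) ^ 2 * 1 + (0 : ℝ≥0∞) * (2 : ℝ≥0∞) ^ (2 + 1) * 0 := by
  rw [Λ_swept_eq]; norm_num

/-- All hypotheses of `DPSystem.lemma_3_7` are met by the witness (so that lemma's conclusion
(28′) — here `≤ 2² · 1 + 0` — is the best possible exponent of `Δ`): the one-step estimates, the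
constants, a proper `2`-colouring, and the initial bounds `γ(ν₀) ≤ 1`, `λ(ν₀) ≤ 0`; and
`DPSystem.lemma_3_7` indeed bounds every swept `ν(I_ℓ H_{ℓ'})` by `4`.
[cite: ConacheEtAl2015, Lemma 3.7] -/
theorem lemma_3_7_hypotheses :
    sys.IsDPStep ∧ sys.Admissible 2 2 0 0 0 ∧ (∀ ℓ, ∀ ℓ' ∈ sys.nbr ℓ, col ℓ' ≠ col ℓ) ∧
      (∀ ℓ, sys.γf ν₀ ℓ ≤ 1) ∧ (∀ a ℓ ℓ', sys.Λ ν₀ a ℓ ℓ' ≤ 0) ∧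
      ∀ a ℓ ℓ', sys.Λ (sys.sweep col ν₀) a ℓ ℓ' ≤ 4 := by
  refine ⟨isDPStep, admissible, col_proper, γ_ν₀, Λ_ν₀, fun a ℓ ℓ' => ?_⟩
  have h := (sys.lemma_3_7 isDPStep admissible col_proper γ_ν₀ Λ_ν₀).2 a ℓ ℓ'
  calc sys.Λ (sys.sweep col ν₀) a ℓ ℓ' ≤ _ := h
    _ = 4 := by norm_num

/-- **Non-vacuity of the threshold.** The witness system (`κ = c = 0`, `K⁻¹ = 0`) is admissible with
`Δ = χ = 2`, `κ̄ = 1/4`, `c̄ = 1/16`, `α = 1/64`, and these constants satisfy the three threshold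
inequalities under which `DobrushinPecherskyCriterion.exists_rate_lt_one` ∕
`DobrushinPecherskySweepRegional.exists_regional_rate_lt_one` produce a rate `r < 1`:
`κ̄ + α < 1`, `c̄Δ^{χ+1} < 1`, `2αΔ^χ < (1 − κ̄ − α)(1 − c̄Δ^{χ+1})` (print's `K > K_*` regime, (13),
(26a)–(26b), with the `χ ↦ χ + 1` reading of E-DP-1) — so those hypotheses are jointly satisfiable.
[cite: ConacheEtAl2015, (13), (26a)–(26b), (srM)] -/
theorem threshold_nonvacuous :
    sys.Admissible 2 2 (1 / 4) (1 / 16) (1 / 64) ∧ ((1 / 4 : ℝ≥0) + 1 / 64 < 1) ∧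
      ((1 / 16 : ℝ≥0) * ((2 : ℕ) : ℝ≥0) ^ (2 + 1) < 1) ∧
      (2 * (1 / 64 : ℝ≥0) * ((2 : ℕ) : ℝ≥0) ^ 2 <
        (1 - ((1 / 4 : ℝ≥0) + 1 / 64)) * (1 - (1 / 16 : ℝ≥0) * ((2 : ℕ) : ℝ≥0) ^ (2 + 1))) := by
  -- numerals with division live more comfortably in `ℝ`; transfer along the coercion
  have le_of_real : ∀ {a b : ℝ≥0}, (a : ℝ) ≤ b → a ≤ b := fun h => NNReal.coe_le_coe.1 h
  have lt_of_real : ∀ {a b : ℝ≥0}, (a : ℝ) < b → a < b := fun h => NNReal.coe_lt_coe.1 h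
  have eq_of_real : ∀ {a b : ℝ≥0}, (a : ℝ) = b → a = b := fun h => NNReal.coe_injective h
  refine ⟨?_, lt_of_real (by push_cast; norm_num), lt_of_real (by push_cast; norm_num), ?_⟩
  · exact
      { two_le := le_rfl
        card_nbr_le := fun ℓ => by
          simp only [sys, cycNbr]
          exact (card_insert_le _ _).trans (by simp)
        κ_row := fun ℓ => by simp [sys]
        c_row := fun a ℓ => by simp [sys]
        κbar_le_one := le_of_real (by push_cast; norm_num)
        cbar_pow_le := le_of_real (by push_cast; norm_num)
        two_mul_alpha_le := le_of_real (by push_cast; norm_num)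
        h26a := by simp [sys] }
  · have h1 : (1 : ℝ≥0) - ((1 / 4 : ℝ≥0) + 1 / 64) = 47 / 64 :=
      tsub_eq_of_eq_add (eq_of_real (by push_cast; norm_num))
    have h2 : (1 : ℝ≥0) - (1 / 16 : ℝ≥0) * ((2 : ℕ) : ℝ≥0) ^ (2 + 1) = 1 / 2 :=
      tsub_eq_of_eq_add (eq_of_real (by push_cast; norm_num))
    rw [h1, h2]
    exact lt_of_real (by push_cast; norm_num)

end Sharpness

end DobrushinPecherskySweep

end Literature.Probability.TransportMaps
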